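import Summits.FinalStateConjecture.FinalStateConjecture.Theorems.EIHFluxBalanceModulatedKerrHandoffOneHoleParams
import Summits.FinalStateConjecture.FinalStateConjecture.Theorems.EIHFluxBalanceModulatedKerrHandoffOneHoleClockBounds
import Summits.FinalStateConjecture.FinalStateConjecture.Theorems.EIHFluxBalanceModulatedKerrHandoffOneHoleBoxes
import Summits.FinalStateConjecture.FinalStateConjecture.Theorems.EIHFluxBalanceModulatedKerrHandoffOneHoleKinematics

/-!
# Route EIHFluxBalance — `ModulatedKerrHandoff`, stub `stub_oneHoleMatching`: the one-hole set-up

Helper file for the crux `stmt-FinalStateConjecture-10167`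
(`Summit.FinalStateConjecture.FinalStateConjecture.Theses.EIHFluxBalance.ModulatedKerrHandoff`),
line `photon-rocket-modulation`, stub `stub_oneHoleMatching` (one-hole profile matching).

This file fixes the data of ONE hole exactly as quantified in the stub — limit parameters `(M, a)`,
core radius `rin`, drifting mass `Mf`, aligned boosts `Λ` with Lorentz factor `≤ γ`, world-line `ξ` of
speed `≤ v < 1`, retarded clock `Uc`, instantaneous Kerr–Schild radius `ρ` — and records the elementary
consequences used by every estimate: the instantaneous
radius is the rest-frame radius of the instantaneous position, `ρ x = r_a(0, Y₀ x)`; hence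
`rin < ρ x` forces the lab distance `d = ‖x̲ − ξ(x⁰)‖ > rin/(1 + 3γ)` and the retardation
`Δ ≥ rin/((1 + 3γ)(1 + v))` (`dist_lower`, `retardation_lower`); smoothness of the parameter maps
`p₁`, `p₀` and of the retarded summand at points of positive retardation and positive retarded
rest-frame radius (`contDiffAt_ret_of_radius_pos`), which is what conclusion (O2) of the stub needs;
and the positive-order `C³` sizes of `p₁`, `p₀` in the FAR regime (`far_ck₁_ret`, `far_ck₁_inst`: the
retarded time may be early there — no tameness — but every growing factor is `O(d)` and carries `ε = 1/d`).
-/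

noncomputable section

-- `Summit.<S>.<S>.…` (single-problem summit, D-0017) trips core's duplicate-namespace linter.
set_option linter.dupNamespace false

open Set Filter Function Literature.Geometry.Lorentzian
open scoped Topology ContDiff

namespace Summit.FinalStateConjecture.FinalStateConjecture.Theorems

namespace OneHole

section Setup

variable {M a rin : ℝ} {Mf : ℝ → ℝ} {Λ : ℝ → lorentzGroup} {ξ : ℝ → E3} {Uc ρ : E4 → ℝ}
  {v A σ γ κ τ₀ : ℝ}

/-! ### The instantaneous radius and the lab distance -/

/-- **The instantaneous Kerr–Schild radius is the rest-frame radius of the instantaneous position**: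
`ρ x = r_a(0, S Λ(x⁰)⁻¹(x − (x⁰, ξ x⁰)))` (the Kerr–Schild radius depends only on the spatial part;
`Kerr.radius_eq_of_spatial_eq`). [folklore] -/
theorem rho_eq (hρ : ∀ x, ρ x = Kerr.radius a (poincareInv (Λ (x 0)) (E4.ofTimeSpace (x 0) (ξ (x 0))) x))
    (x : E4) :
    ρ x = Kerr.radius a (E4.ofTimeSpace 0
      (E4.spatial ((Λ (x 0) : E4 ≃L[ℝ] E4).symm (x - E4.ofTimeSpace (x 0) (ξ (x 0)))))) := by
  rw [hρ x]
  exact Kerr.radius_eq_of_spatial_eq a (by rw [E4.spatial_ofTimeSpace]; rfl)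

/-- The rest-frame radius is at most the norm of the position: `r_a(0, w) ≤ ‖w‖`. [folklore] -/
theorem radius_slice_le_norm (a : ℝ) (w : E3) : Kerr.radius a (E4.ofTimeSpace 0 w) ≤ ‖w‖ := by
  have h := Kerr.radius_le_spatialNorm a (E4.ofTimeSpace 0 w)
  rwa [E4.spatialNorm_ofTimeSpace] at h

/-- **Off the core the point is a definite lab distance from the centre**:
`rin < ρ x ⇒ rin < (1 + 3γ) ‖x̲ − ξ(x⁰)‖`. [folklore] -/
theorem dist_lower (hal : ∀ u, (Λ u : E4 ≃L[ℝ] E4) (E4.basisVector 0) =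
      ((Λ u : E4 ≃L[ℝ] E4) (E4.basisVector 0)) 0 • E4.ofTimeSpace 1 (deriv ξ u) ∧
      1 ≤ ((Λ u : E4 ≃L[ℝ] E4) (E4.basisVector 0)) 0 ∧ ((Λ u : E4 ≃L[ℝ] E4) (E4.basisVector 0)) 0 ≤ γ)
    (hρ : ∀ x, ρ x = Kerr.radius a (poincareInv (Λ (x 0)) (E4.ofTimeSpace (x 0) (ξ (x 0))) x))
    {x : E4} (hx : rin < ρ x) : rin < (1 + 3 * γ) * ‖E4.spatial x - ξ (x 0)‖ := by
  rw [rho_eq hρ] at hx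
  have h1 := radius_slice_le_norm a
    (E4.spatial ((Λ (x 0) : E4 ≃L[ℝ] E4).symm (x - E4.ofTimeSpace (x 0) (ξ (x 0)))))
  have h2 := (norm_restPosition_inst (Λ := Λ (x 0)) (x := x) (t := x 0) rfl (ξ (x 0)) (hal (x 0)).2.1
    (hal (x 0)).2.2).2
  have h3 : Kerr.radius a (E4.ofTimeSpace 0
      (E4.spatial ((Λ (x 0) : E4 ≃L[ℝ] E4).symm (x - E4.ofTimeSpace (x 0) (ξ (x 0)))))) ≤
      (1 + 3 * γ) * ‖E4.spatial x - ξ (x 0)‖ := h1.trans h2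
  exact hx.trans_le h3

/-- **Off the core the retardation is bounded below**:
`rin < ρ x ⇒ rin < (1 + 3γ)(1 + v)(x⁰ − U x)`. [folklore] -/
theorem retardation_lower (hsm : ContDiff ℝ ∞ ξ) (hvel : 0 ≤ v ∧ v < 1 ∧ ∀ u, ‖deriv ξ u‖ ≤ v)
    (hal : ∀ u, (Λ u : E4 ≃L[ℝ] E4) (E4.basisVector 0) =
      ((Λ u : E4 ≃L[ℝ] E4) (E4.basisVector 0)) 0 • E4.ofTimeSpace 1 (deriv ξ u) ∧
      1 ≤ ((Λ u : E4 ≃L[ℝ] E4) (E4.basisVector 0)) 0 ∧ ((Λ u : E4 ≃L[ℝ] E4) (E4.basisVector 0)) 0 ≤ γ)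
    (hclock : ∀ x, x 0 - Uc x = ‖E4.spatial x - ξ (Uc x)‖)
    (hρ : ∀ x, ρ x = Kerr.radius a (poincareInv (Λ (x 0)) (E4.ofTimeSpace (x 0) (ξ (x 0))) x))
    {x : E4} (hx : rin < ρ x) : rin < (1 + 3 * γ) * (1 + v) * (x 0 - Uc x) := by
  have h1 := dist_lower hal hρ hx
  have h2 := dist_le_retardation hsm hvel.1 hvel.2.2 hclock x
  have hγ : 0 ≤ 1 + 3 * γ := by linarith [one_le_gamma hal]
  nlinarith

/-! ### Smoothness of the retarded summand -/

/-- **The retarded summand is `C^∞` at a point of positive retardation whose retarded rest-frame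
radius is positive** (chain rule: the clock is smooth there, the moduli are smooth, the Kerr–Schild
form is jointly smooth in (mass, point) off the ring, and `(T, L) ↦ T(L·, L·)` is polynomial).
[cite: KerrSchild1965, §3] -/
theorem contDiffAt_ret_of_radius_pos
    (hsm : ContDiff ℝ ∞ ξ ∧ ContDiff ℝ ∞ (fun t ↦ ((Λ t : E4 ≃L[ℝ] E4) : E4 →L[ℝ] E4)) ∧ ContDiff ℝ ∞ Mf)
    (hvel : 0 ≤ v ∧ v < 1 ∧ ∀ u, ‖deriv ξ u‖ ≤ v)
    (hclock : ∀ x, x 0 - Uc x = ‖E4.spatial x - ξ (Uc x)‖)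
    (hU : ContDiffOn ℝ ∞ Uc {x : E4 | E4.spatial x ≠ ξ (Uc x)}) {x : E4} (hΔ : x 0 - Uc x ≠ 0)
    (hrad : 0 < Kerr.radius a ((Λ (Uc x) : E4 ≃L[ℝ] E4).symm (x - E4.ofTimeSpace (Uc x) (ξ (Uc x))))) :
    ContDiffAt ℝ ∞ (fun y ↦ boostedKerrBilin (Λ (Uc y)) (E4.ofTimeSpace (Uc y) (ξ (Uc y))) (Mf (Uc y)) a y
      - Minkowski.bilin) x := by
  have hUs : ContDiffAt ℝ ∞ Uc x := contDiffAt_clock hsm.1 hvel.1 hvel.2.1 hvel.2.2 hclock hU hΔ le_rfl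
  have hθ : ContDiffAt ℝ ∞ (fun y ↦ (((Λ (Uc y) : E4 ≃L[ℝ] E4).symm : E4 ≃L[ℝ] E4) : E4 →L[ℝ] E4)) x :=
    (contDiff_theta hsm.2.1).contDiffAt.comp x hUs
  have hc : ContDiffAt ℝ ∞ (fun y ↦ E4.ofTimeSpace (Uc y) (ξ (Uc y))) x :=
    (contDiff_centre hsm.1).contDiffAt.comp x hUs
  have hz : ContDiffAt ℝ ∞ (fun y ↦ (Λ (Uc y) : E4 ≃L[ℝ] E4).symm (y - E4.ofTimeSpace (Uc y) (ξ (Uc y)))) x :=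
    hθ.clm_apply (contDiffAt_id.sub hc)
  have hm : ContDiffAt ℝ ∞ (fun y ↦ Mf (Uc y)) x := hsm.2.2.contDiffAt.comp x hUs
  have hq : ContDiffAt ℝ ∞ (fun y ↦ ((Mf (Uc y), (a, (Λ (Uc y) : E4 ≃L[ℝ] E4).symm
      (y - E4.ofTimeSpace (Uc y) (ξ (Uc y))))) : ℝ × (ℝ × E4))) x :=
    hm.prodMk (contDiffAt_const.prodMk hz)
  have hK : ContDiffAt ℝ ∞ (fun y ↦ Kerr.bilin (Mf (Uc y)) a ((Λ (Uc y) : E4 ≃L[ℝ] E4).symm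
      (y - E4.ofTimeSpace (Uc y) (ξ (Uc y)))) - Minkowski.bilin) x :=
    (contDiffAt_ksPert₃ (q := (Mf (Uc x), (a, (Λ (Uc x) : E4 ≃L[ℝ] E4).symm
      (x - E4.ofTimeSpace (Uc x) (ξ (Uc x)))))) hrad).comp x hq
  have hB := contDiffWithinAt_bilinearComp_self (s := univ) hK.contDiffWithinAt hθ.contDiffWithinAt
  refine (contDiffWithinAt_univ.mp hB).congr_of_eventuallyEq (Eventually.of_forall fun y ↦ ?_)
  refine ContinuousLinearMap.ext fun u ↦ ContinuousLinearMap.ext fun w ↦ ?_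
  rw [ContinuousLinearMap.bilinearComp_apply, boostedKerrBilin_sub_minkowski_apply]
  rfl

/-! ### Sizes of the parameter maps in the far regime -/

/-- **Size of the retarded parameter map in the far regime.** [folklore] -/
theorem far_ck₁_ret
    (hsm : ContDiff ℝ ∞ ξ ∧ ContDiff ℝ ∞ (fun t ↦ ((Λ t : E4 ≃L[ℝ] E4) : E4 →L[ℝ] E4)) ∧ ContDiff ℝ ∞ Mf)
    (hal : ∀ u, (Λ u : E4 ≃L[ℝ] E4) (E4.basisVector 0) =
      ((Λ u : E4 ≃L[ℝ] E4) (E4.basisVector 0)) 0 • E4.ofTimeSpace 1 (deriv ξ u) ∧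
      1 ≤ ((Λ u : E4 ≃L[ℝ] E4) (E4.basisVector 0)) 0 ∧ ((Λ u : E4 ≃L[ℝ] E4) (E4.basisVector 0)) 0 ≤ γ)
    (hgl : ∀ u, (∀ k, 1 ≤ k → k ≤ 5 → ‖iteratedDeriv k ξ u‖ ≤ A) ∧
      ∀ k ≤ 4, ‖iteratedDeriv k (fun t ↦ ((Λ t : E4 ≃L[ℝ] E4) : E4 →L[ℝ] E4)) u‖ ≤ A ∧
        |iteratedDeriv k Mf u| ≤ A)
    {Cθ : ℝ} (hCθ0 : 0 ≤ Cθ)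
    (hCθ : ∀ (k : ℕ) (u : ℝ),
      ‖iteratedDeriv k (fun t ↦ (((Λ t : E4 ≃L[ℝ] E4).symm : E4 ≃L[ℝ] E4) : E4 →L[ℝ] E4)) u‖ ≤
        Cθ * ‖iteratedDeriv k (fun t ↦ ((Λ t : E4 ≃L[ℝ] E4) : E4 →L[ℝ] E4)) u‖)
    {DU : ℝ} (hDU1 : 1 ≤ DU) {x : E4}
    (hUx : ContDiffAt ℝ 3 Uc x ∧ ∀ i, 1 ≤ i → i ≤ 3 → ‖iteratedFDeriv ℝ i Uc x‖ ≤ DU)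
    {ε X₀ Xb : ℝ} (hε : 0 < ε) (hε1 : ε ≤ 1) (hX₀ : ε * ‖x‖ ≤ X₀)
    (hXb : ε * (|Uc x| + ‖ξ (Uc x)‖ + 1 + A) ≤ Xb) :
    ContDiffAt ℝ 3 (fun y ↦ ((Mf (Uc y), ((((Λ (Uc y) : E4 ≃L[ℝ] E4).symm : E4 ≃L[ℝ] E4) : E4 →L[ℝ] E4),
        (ε * a, ε • E4.spatial ((Λ (Uc y) : E4 ≃L[ℝ] E4).symm (y - E4.ofTimeSpace (Uc y) (ξ (Uc y))))))) :
        ℝ × ((E4 →L[ℝ] E4) × (ℝ × E3)))) x ∧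
      ∀ i, 1 ≤ i → i ≤ 3 → ‖iteratedFDeriv ℝ i (fun y ↦ ((Mf (Uc y),
        ((((Λ (Uc y) : E4 ≃L[ℝ] E4).symm : E4 ≃L[ℝ] E4) : E4 →L[ℝ] E4),
        (ε * a, ε • E4.spatial ((Λ (Uc y) : E4 ≃L[ℝ] E4).symm (y - E4.ofTimeSpace (Uc y) (ξ (Uc y))))))) :
        ℝ × ((E4 →L[ℝ] E4) × (ℝ × E3)))) x‖ ≤
        max (6 * A * DU ^ 3) (max (6 * (Cθ * A) * DU ^ 3)
          (max 0 (6 * (Cθ * A) * DU ^ 3 * X₀ + 8 * ((1 + 3 * γ) + 6 * (Cθ * A) * DU ^ 3) +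
            6 * (4 * (Cθ * A) * Xb) * DU ^ 3))) := by
  have hA0 : 0 ≤ A := A_nonneg hgl
  -- mass
  have hm : ContDiffAt ℝ 3 Mf (Uc x) ∧ ∀ i, 1 ≤ i → i ≤ 3 → ‖iteratedFDeriv ℝ i Mf (Uc x)‖ ≤ A :=
    ck₁_of_iteratedDeriv (n := 3) (hsm.2.2.of_le (WithTop.coe_le_coe.mpr le_top)).contDiffAt
      fun i _ hi ↦ by rw [Real.norm_eq_abs]; exact ((hgl (Uc x)).2 i (by omega)).2
  have hmU := ck₁_comp_of_ck₁ hm hUx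
  rw [max_eq_left hA0, max_eq_right hDU1, show (Nat.factorial 3 : ℝ) = 6 by norm_num] at hmU
  -- inverse boost
  have hθ4 := ck₁_theta_global hCθ hsm.2.1 hCθ0 (fun u k hk ↦ ((hgl u).2 k hk).1) (Uc x)
  have hθ : ContDiffAt ℝ 3 (fun t ↦ (((Λ t : E4 ≃L[ℝ] E4).symm : E4 ≃L[ℝ] E4) : E4 →L[ℝ] E4)) (Uc x) ∧
      ∀ i, 1 ≤ i → i ≤ 3 → ‖iteratedFDeriv ℝ i
        (fun t ↦ (((Λ t : E4 ≃L[ℝ] E4).symm : E4 ≃L[ℝ] E4) : E4 →L[ℝ] E4)) (Uc x)‖ ≤ Cθ * A :=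
    ck₁_mono hθ4 (by norm_num) le_rfl
  have hθU := ck₁_comp_of_ck₁ hθ hUx
  have hCA : 0 ≤ Cθ * A := mul_nonneg hCθ0 hA0
  rw [max_eq_left hCA, max_eq_right hDU1, show (Nat.factorial 3 : ℝ) = 6 by norm_num] at hθU
  -- spin
  have ha := ck₁_const 3 (ε * a) x
  -- position
  have hb := ck₁_restOffset hsm.2.1 hsm.1 (fun u ↦ (hgl u).1) (fun u ↦ ⟨(hal u).1, (hal u).2.1⟩) hθ4
  have hW := ck₁_scaledPosition (θp := fun t ↦ (((Λ t : E4 ≃L[ℝ] E4).symm : E4 ≃L[ℝ] E4) : E4 →L[ℝ] E4))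
    (bp := fun u ↦ E4.spatial ((Λ u : E4 ≃L[ℝ] E4).symm (E4.ofTimeSpace u (ξ u)))) (τ := Uc) (x := x)
    hUx hDU1 (norm_theta_le (hal (Uc x)).2.1 (hal (Uc x)).2.2) hθ hb hε
  have hWeq : (fun y ↦ ε • (E4.spatial ((((Λ (Uc y) : E4 ≃L[ℝ] E4).symm : E4 ≃L[ℝ] E4) : E4 →L[ℝ] E4) y) -
      E4.spatial ((Λ (Uc y) : E4 ≃L[ℝ] E4).symm (E4.ofTimeSpace (Uc y) (ξ (Uc y)))))) =
      fun y ↦ ε • E4.spatial ((Λ (Uc y) : E4 ≃L[ℝ] E4).symm (y - E4.ofTimeSpace (Uc y) (ξ (Uc y)))) := by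
    funext y
    rw [map_sub, map_sub, ContinuousLinearEquiv.coe_coe]
  rw [hWeq] at hW
  have hW' := ck₁_mono hW le_rfl (show ε * (6 * (Cθ * A) * DU ^ 3 * ‖x‖ + 8 * ((1 + 3 * γ) +
      6 * (Cθ * A) * DU ^ 3) + 6 * (4 * (Cθ * A) * (|Uc x| + ‖ξ (Uc x)‖ + 1 + A)) * DU ^ 3) ≤
      6 * (Cθ * A) * DU ^ 3 * X₀ + 8 * ((1 + 3 * γ) + 6 * (Cθ * A) * DU ^ 3) +
        6 * (4 * (Cθ * A) * Xb) * DU ^ 3 from ?_)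
  · exact ck₁_prodMk hmU (ck₁_prodMk hθU (ck₁_prodMk ha hW'))
  · have hD3 : 0 ≤ DU ^ 3 := by positivity
    have hγ : 0 ≤ 1 + 3 * γ := by linarith [one_le_gamma hal]
    have e1 : ε * (6 * (Cθ * A) * DU ^ 3 * ‖x‖) ≤ 6 * (Cθ * A) * DU ^ 3 * X₀ := by
      calc ε * (6 * (Cθ * A) * DU ^ 3 * ‖x‖) = 6 * (Cθ * A) * DU ^ 3 * (ε * ‖x‖) := by ring
        _ ≤ 6 * (Cθ * A) * DU ^ 3 * X₀ := mul_le_mul_of_nonneg_left hX₀ (by positivity)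
    have e2 : ε * (8 * ((1 + 3 * γ) + 6 * (Cθ * A) * DU ^ 3)) ≤ 8 * ((1 + 3 * γ) + 6 * (Cθ * A) * DU ^ 3) :=
      mul_le_of_le_one_left (by positivity) hε1
    have e3 : ε * (6 * (4 * (Cθ * A) * (|Uc x| + ‖ξ (Uc x)‖ + 1 + A)) * DU ^ 3) ≤
        6 * (4 * (Cθ * A) * Xb) * DU ^ 3 := by
      calc ε * (6 * (4 * (Cθ * A) * (|Uc x| + ‖ξ (Uc x)‖ + 1 + A)) * DU ^ 3)
          = 6 * (4 * (Cθ * A) * (ε * (|Uc x| + ‖ξ (Uc x)‖ + 1 + A))) * DU ^ 3 := by ring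
        _ ≤ 6 * (4 * (Cθ * A) * Xb) * DU ^ 3 := by gcongr
    calc _ = ε * (6 * (Cθ * A) * DU ^ 3 * ‖x‖) + ε * (8 * ((1 + 3 * γ) + 6 * (Cθ * A) * DU ^ 3)) +
          ε * (6 * (4 * (Cθ * A) * (|Uc x| + ‖ξ (Uc x)‖ + 1 + A)) * DU ^ 3) := by ring
      _ ≤ _ := add_le_add (add_le_add e1 e2) e3

/-- **Size of the instantaneous parameter map** (clock `y ↦ y⁰`, of positive-order size `1`).
[folklore] -/
theorem far_ck₁_inst
    (hsm : ContDiff ℝ ∞ ξ ∧ ContDiff ℝ ∞ (fun t ↦ ((Λ t : E4 ≃L[ℝ] E4) : E4 →L[ℝ] E4)) ∧ ContDiff ℝ ∞ Mf)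
    (hal : ∀ u, (Λ u : E4 ≃L[ℝ] E4) (E4.basisVector 0) =
      ((Λ u : E4 ≃L[ℝ] E4) (E4.basisVector 0)) 0 • E4.ofTimeSpace 1 (deriv ξ u) ∧
      1 ≤ ((Λ u : E4 ≃L[ℝ] E4) (E4.basisVector 0)) 0 ∧ ((Λ u : E4 ≃L[ℝ] E4) (E4.basisVector 0)) 0 ≤ γ)
    (hgl : ∀ u, (∀ k, 1 ≤ k → k ≤ 5 → ‖iteratedDeriv k ξ u‖ ≤ A) ∧
      ∀ k ≤ 4, ‖iteratedDeriv k (fun t ↦ ((Λ t : E4 ≃L[ℝ] E4) : E4 →L[ℝ] E4)) u‖ ≤ A ∧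
        |iteratedDeriv k Mf u| ≤ A)
    {Cθ : ℝ} (hCθ0 : 0 ≤ Cθ)
    (hCθ : ∀ (k : ℕ) (u : ℝ),
      ‖iteratedDeriv k (fun t ↦ (((Λ t : E4 ≃L[ℝ] E4).symm : E4 ≃L[ℝ] E4) : E4 →L[ℝ] E4)) u‖ ≤
        Cθ * ‖iteratedDeriv k (fun t ↦ ((Λ t : E4 ≃L[ℝ] E4) : E4 →L[ℝ] E4)) u‖)
    {x : E4} {ε X₀ Xb : ℝ} (hε : 0 < ε) (hε1 : ε ≤ 1) (hX₀ : ε * ‖x‖ ≤ X₀)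
    (hXb : ε * (|x 0| + ‖ξ (x 0)‖ + 1 + A) ≤ Xb) :
    ContDiffAt ℝ 3 (fun y ↦ ((M, ((((Λ (y 0) : E4 ≃L[ℝ] E4).symm : E4 ≃L[ℝ] E4) : E4 →L[ℝ] E4),
        (ε * a, ε • E4.spatial ((Λ (y 0) : E4 ≃L[ℝ] E4).symm (y - E4.ofTimeSpace (y 0) (ξ (y 0))))))) :
        ℝ × ((E4 →L[ℝ] E4) × (ℝ × E3)))) x ∧
      ∀ i, 1 ≤ i → i ≤ 3 → ‖iteratedFDeriv ℝ i (fun y ↦ ((M,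
        ((((Λ (y 0) : E4 ≃L[ℝ] E4).symm : E4 ≃L[ℝ] E4) : E4 →L[ℝ] E4),
        (ε * a, ε • E4.spatial ((Λ (y 0) : E4 ≃L[ℝ] E4).symm (y - E4.ofTimeSpace (y 0) (ξ (y 0))))))) :
        ℝ × ((E4 →L[ℝ] E4) × (ℝ × E3)))) x‖ ≤
        max 0 (max (6 * (Cθ * A))
          (max 0 (6 * (Cθ * A) * X₀ + 8 * ((1 + 3 * γ) + 6 * (Cθ * A)) + 6 * (4 * (Cθ * A) * Xb)))) := by
  have hA0 : 0 ≤ A := A_nonneg hgl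
  have hCA : 0 ≤ Cθ * A := mul_nonneg hCθ0 hA0
  have hπ : ContDiffAt ℝ 3 (fun y : E4 ↦ y 0) x ∧
      ∀ i, 1 ≤ i → i ≤ 3 → ‖iteratedFDeriv ℝ i (fun y : E4 ↦ y 0) x‖ ≤ 1 :=
    ck₁_mono (ck₁_clm 3 (EuclideanSpace.proj (0 : Fin 4) : E4 →L[ℝ] ℝ) x) le_rfl norm_dt_le
  -- mass
  have hm := ck₁_const 3 M x
  -- inverse boost
  have hθ4 := ck₁_theta_global hCθ hsm.2.1 hCθ0 (fun u k hk ↦ ((hgl u).2 k hk).1) (x 0)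
  have hθ : ContDiffAt ℝ 3 (fun t ↦ (((Λ t : E4 ≃L[ℝ] E4).symm : E4 ≃L[ℝ] E4) : E4 →L[ℝ] E4)) (x 0) ∧
      ∀ i, 1 ≤ i → i ≤ 3 → ‖iteratedFDeriv ℝ i
        (fun t ↦ (((Λ t : E4 ≃L[ℝ] E4).symm : E4 ≃L[ℝ] E4) : E4 →L[ℝ] E4)) (x 0)‖ ≤ Cθ * A :=
    ck₁_mono hθ4 (by norm_num) le_rfl
  have hθt := ck₁_comp_of_ck₁ (g := fun t ↦ (((Λ t : E4 ≃L[ℝ] E4).symm : E4 ≃L[ℝ] E4) : E4 →L[ℝ] E4))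
    (f := fun y : E4 ↦ y 0) (x := x) hθ hπ
  rw [max_eq_left hCA, max_self, one_pow, mul_one, show (Nat.factorial 3 : ℝ) = 6 by norm_num] at hθt
  -- spin
  have ha := ck₁_const 3 (ε * a) x
  -- position
  have hb := ck₁_restOffset hsm.2.1 hsm.1 (fun u ↦ (hgl u).1) (fun u ↦ ⟨(hal u).1, (hal u).2.1⟩) hθ4
  have hW := ck₁_scaledPosition (θp := fun t ↦ (((Λ t : E4 ≃L[ℝ] E4).symm : E4 ≃L[ℝ] E4) : E4 →L[ℝ] E4))
    (bp := fun u ↦ E4.spatial ((Λ u : E4 ≃L[ℝ] E4).symm (E4.ofTimeSpace u (ξ u)))) (τ := fun y : E4 ↦ y 0)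
    (x := x) hπ le_rfl (norm_theta_le (hal (x 0)).2.1 (hal (x 0)).2.2) hθ hb hε
  have hWeq : (fun y : E4 ↦ ε • (E4.spatial ((((Λ (y 0) : E4 ≃L[ℝ] E4).symm : E4 ≃L[ℝ] E4) : E4 →L[ℝ] E4) y) -
      E4.spatial ((Λ (y 0) : E4 ≃L[ℝ] E4).symm (E4.ofTimeSpace (y 0) (ξ (y 0)))))) =
      fun y ↦ ε • E4.spatial ((Λ (y 0) : E4 ≃L[ℝ] E4).symm (y - E4.ofTimeSpace (y 0) (ξ (y 0)))) := by
    funext y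
    rw [map_sub, map_sub, ContinuousLinearEquiv.coe_coe]
  rw [hWeq, one_pow] at hW
  have hW' := ck₁_mono hW le_rfl (show ε * (6 * (Cθ * A) * 1 * ‖x‖ + 8 * ((1 + 3 * γ) +
      6 * (Cθ * A) * 1) + 6 * (4 * (Cθ * A) * (|x 0| + ‖ξ (x 0)‖ + 1 + A)) * 1) ≤
      6 * (Cθ * A) * X₀ + 8 * ((1 + 3 * γ) + 6 * (Cθ * A)) + 6 * (4 * (Cθ * A) * Xb) from ?_)
  · exact ck₁_prodMk hm (ck₁_prodMk hθt (ck₁_prodMk ha hW'))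
  · have hγ : 0 ≤ 1 + 3 * γ := by linarith [one_le_gamma hal]
    have e1 : ε * (6 * (Cθ * A) * 1 * ‖x‖) ≤ 6 * (Cθ * A) * X₀ := by
      calc ε * (6 * (Cθ * A) * 1 * ‖x‖) = 6 * (Cθ * A) * (ε * ‖x‖) := by ring
        _ ≤ 6 * (Cθ * A) * X₀ := mul_le_mul_of_nonneg_left hX₀ (by positivity)
    have e2 : ε * (8 * ((1 + 3 * γ) + 6 * (Cθ * A) * 1)) ≤ 8 * ((1 + 3 * γ) + 6 * (Cθ * A)) := by
      rw [mul_one]; exact mul_le_of_le_one_left (by positivity) hε1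
    have e3 : ε * (6 * (4 * (Cθ * A) * (|x 0| + ‖ξ (x 0)‖ + 1 + A)) * 1) ≤ 6 * (4 * (Cθ * A) * Xb) := by
      calc ε * (6 * (4 * (Cθ * A) * (|x 0| + ‖ξ (x 0)‖ + 1 + A)) * 1)
          = 6 * (4 * (Cθ * A) * (ε * (|x 0| + ‖ξ (x 0)‖ + 1 + A))) := by ring
        _ ≤ 6 * (4 * (Cθ * A) * Xb) := by gcongr
    calc _ = ε * (6 * (Cθ * A) * 1 * ‖x‖) + ε * (8 * ((1 + 3 * γ) + 6 * (Cθ * A) * 1)) +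
          ε * (6 * (4 * (Cθ * A) * (|x 0| + ‖ξ (x 0)‖ + 1 + A)) * 1) := by ring
      _ ≤ _ := add_le_add (add_le_add e1 e2) e3

end Setup

end OneHole

/-- Registered sub-goal form (stub `oneHole_radius_slice_le_norm` of the crux item) of
`OneHole.radius_slice_le_norm`: `r_a(0, w) ≤ ‖w‖`. [folklore] -/
theorem oneHole_radius_slice_le_norm : open Literature.Geometry.Lorentzian in ∀ (a : ℝ) (w : E3), Kerr.radius a (E4.ofTimeSpace 0 w) ≤ ‖w‖ :=
  fun a w ↦ OneHole.radius_slice_le_norm a w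

end Summit.FinalStateConjecture.FinalStateConjecture.Theorems

end
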